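import Literature.Topology.FourManifolds.PrismComplex
import HarnessLib

/-!
# The product complex `K × [t₀, t_N]` of a finite complex with a subdivided interval

For a finite geometric simplicial complex `K` in a finite-dimensional real normed space `W`
(vertices inside a duplicate-free list `L`, which fixes a global vertex order) and levels
`t 0 < t 1 < ⋯ < t N`, the staircase prism complexes (`PrismComplex.lean`) over the faces of
`K`, slab by slab, form **one geometric simplicial complex** `productComplex` in `W × ℝ` with
underlying space `|K| × ⋃ₐ [t a, t (a+1)]` (`productComplex_space`).  The compatibility of the
prisms rests on:

* `prismFaces_filter_iff` — the faces of the prism over `σ` with all vertices over a subface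
  `S` are exactly the faces of the prism over `S` (same global order);
* `mem_convexHull_filter_fst` — *vertical faces*: a point of a closed prism simplex projecting
  into `conv S` lies in the closed simplex of the vertices over `S` (affine independence of
  `σ`);
* `mem_convexHull_filter_of_snd_eq_max` / `…_of_snd_eq` — the extreme levels of a closed
  simplex are spanned by the extreme vertices;

so that two prism faces in the same slab meet inside the prism over `σ₁ ∩ σ₂`
(`inter_subset_same_slab`), faces in adjacent slabs meet at the common level where the base
complex governs (`inter_subset_adjacent_slab`), and faces in far-apart slabs do not meet.

This is the cell structure `L × I` of the homotopy track in the engulfing theorems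
(Rushing 1973, Thms. 4.2.1, 4.12.1), as a genuine simplicial complex on which PL maps,
general position (`PLGeneralPosition.lean`) and the explicit expansions of the prisms can be
run.  Everything is proved; `faceList`, `productFaces`, `productComplex` are explicit; no named
facts.

## References

* C. P. Rourke, B. J. Sanderson, *Introduction to Piecewise-Linear Topology*, Springer (1972),
  Ch. 2. [RourkeSanderson1972]
* T. B. Rushing, *Topological Embeddings*, Academic Press (1973), proofs of Thms. 4.2.1 and
  4.12.1. [Rushing1973]
-/

open Set Function

noncomputable section

namespace Literature.Topology.FourManifolds

open Literature.Analysis.Convexity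

section Comb

variable {W : Type*} [DecidableEq W] {t₀ t₁ : ℝ}

/-! ### Restriction to a sub-face: the staircase over a sublist -/

/-- **Faces over a vertex subset are faces of the sub-prism**: a nonempty set of vertices of a
staircase simplex of `l` all lying over `S` is contained in a staircase simplex of the sublist
`l.filter (· ∈ S)`. [folklore] -/
theorem exists_subset_stair_filter (S : Finset W) :
    ∀ (l : List W) (i : ℕ) (F : Finset (W × ℝ)), F ⊆ stair t₀ t₁ l i → F.Nonempty →
      (∀ q ∈ F, q.1 ∈ S) →
      ∃ j, j < (l.filter fun w => w ∈ S).length ∧ F ⊆ stair t₀ t₁ (l.filter fun w => w ∈ S) j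
  | [], i, F, hF, hne, _ => by
      obtain ⟨q, hq⟩ := hne
      have := hF hq
      simp [stair] at this
  | v :: rest, 0, F, hF, hne, hS => by
      rw [stair_cons_zero] at hF
      by_cases hv : v ∈ S
      · refine ⟨0, by simp [List.filter_cons_of_pos, hv], ?_⟩
        rw [List.filter_cons_of_pos (by simpa using hv), stair_cons_zero]
        intro q hq
        rcases Finset.mem_insert.1 (hF hq) with h | h
        · exact Finset.mem_insert.2 (Or.inl h)
        · obtain ⟨w, hw, rfl⟩ := mem_bottomSimplex.1 h
          refine Finset.mem_insert_of_mem (mem_bottomSimplex.2 ⟨w, ?_, rfl⟩)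
          have hwS : w ∈ S := hS _ hq
          rcases List.mem_cons.1 hw with rfl | hw
          · exact List.mem_cons_self
          · exact List.mem_cons_of_mem _ (List.mem_filter.2 ⟨hw, by simpa using hwS⟩)
      · -- `top v ∉ F`, all vertices are bottoms over `rest ∩ S`
        have hsub : F ⊆ bottomSimplex t₀ (rest.filter fun w => w ∈ S) := by
          intro q hq
          have hqS := hS q hq
          rcases Finset.mem_insert.1 (hF hq) with h | h
          · rw [h] at hqS; exact absurd hqS hv
          · obtain ⟨w, hw, rfl⟩ := mem_bottomSimplex.1 h
            rcases List.mem_cons.1 hw with rfl | hw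
            · exact absurd hqS hv
            · exact mem_bottomSimplex.2 ⟨w, List.mem_filter.2 ⟨hw, by simpa using hqS⟩, rfl⟩
        rw [List.filter_cons_of_neg (by simpa using hv)]
        obtain ⟨q, hq⟩ := hne
        obtain ⟨w, hw, -⟩ := mem_bottomSimplex.1 (hsub hq)
        obtain ⟨w₀, rest', hrest⟩ := List.exists_cons_of_ne_nil (List.ne_nil_of_mem hw)
        refine ⟨0, by rw [hrest]; simp, ?_⟩
        rw [hrest, stair_cons_zero, ← hrest]
        exact hsub.trans (Finset.subset_insert _ _)
  | v :: rest, i + 1, F, hF, hne, hS => by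
      rw [stair_cons_succ] at hF
      set F' := F.erase (liftV t₁ v) with hF'
      have hF's : F' ⊆ stair t₀ t₁ rest i := fun q hq => by
        have hq' := Finset.mem_erase.1 hq
        exact (Finset.mem_insert.1 (hF hq'.2)).resolve_left hq'.1
      rcases F'.eq_empty_or_nonempty with h0 | hne'
      · -- `F = {top v}`
        obtain ⟨q, hq⟩ := hne
        have hqv : q = liftV t₁ v := by
          by_contra h
          have : q ∈ F' := Finset.mem_erase.2 ⟨h, hq⟩
          rw [h0] at this; exact absurd this (Finset.notMem_empty q)
        have hv : v ∈ S := by have := hS q hq; rwa [hqv] at this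
        refine ⟨0, by simp [List.filter_cons_of_pos, hv], ?_⟩
        rw [List.filter_cons_of_pos (by simpa using hv), stair_cons_zero]
        intro q' hq'
        have : q' = liftV t₁ v := by
          by_contra h
          have : q' ∈ F' := Finset.mem_erase.2 ⟨h, hq'⟩
          rw [h0] at this; exact absurd this (Finset.notMem_empty q')
        rw [this]; exact Finset.mem_insert_self _ _
      · obtain ⟨j, hj, hsub⟩ := exists_subset_stair_filter S rest i F' hF's hne'
          (fun q hq => hS q (Finset.mem_of_mem_erase hq))
        by_cases hv : v ∈ S
        · refine ⟨j + 1, by simpa [List.filter_cons_of_pos, hv] using hj, ?_⟩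
          rw [List.filter_cons_of_pos (by simpa using hv), stair_cons_succ]
          intro q hq
          by_cases hqv : q = liftV t₁ v
          · rw [hqv]; exact Finset.mem_insert_self _ _
          · exact Finset.mem_insert_of_mem (hsub (Finset.mem_erase.2 ⟨hqv, hq⟩))
        · have hFF' : F = F' := by
            refine (Finset.erase_eq_of_notMem fun h => hv ?_).symm
            simpa using hS _ h
          refine ⟨j, by simpa [List.filter_cons_of_neg, hv] using hj, ?_⟩
          rw [List.filter_cons_of_neg (by simpa using hv), hFF']
          exact hsub

/-- **Faces of the sub-prism are faces of the prism.** [folklore] -/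
theorem exists_stair_filter_subset (S : Finset W) :
    ∀ (l : List W) (j : ℕ), j < (l.filter fun w => w ∈ S).length →
      ∃ i, i < l.length ∧ stair t₀ t₁ (l.filter fun w => w ∈ S) j ⊆ stair t₀ t₁ l i
  | [], j, hj => by simp at hj
  | v :: rest, j, hj => by
      by_cases hv : v ∈ S
      · rw [List.filter_cons_of_pos (by simpa using hv)] at hj ⊢
        rcases j with _ | j'
        · refine ⟨0, by simp, ?_⟩
          rw [stair_cons_zero, stair_cons_zero]
          refine Finset.insert_subset_insert _ fun q hq => ?_
          obtain ⟨w, hw, rfl⟩ := mem_bottomSimplex.1 hq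
          refine mem_bottomSimplex.2 ⟨w, ?_, rfl⟩
          rcases List.mem_cons.1 hw with rfl | hw
          · exact List.mem_cons_self
          · exact List.mem_cons_of_mem _ (List.mem_of_mem_filter hw)
        · obtain ⟨i, hi, hsub⟩ := exists_stair_filter_subset S rest j' (by simpa using hj)
          refine ⟨i + 1, by simpa using hi, ?_⟩
          rw [stair_cons_succ, stair_cons_succ]
          exact Finset.insert_subset_insert _ hsub
      · rw [List.filter_cons_of_neg (by simpa using hv)] at hj ⊢
        obtain ⟨i, hi, hsub⟩ := exists_stair_filter_subset S rest j hj
        refine ⟨i + 1, by simpa using hi, ?_⟩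
        rw [stair_cons_succ]
        exact hsub.trans (Finset.subset_insert _ _)

/-- **Restriction of the face family to a vertex subset.** [folklore] -/
theorem prismFaces_filter_iff (S : Finset W) (l : List W) (F : Finset (W × ℝ)) :
    F ∈ prismFaces t₀ t₁ (l.filter fun w => w ∈ S) ↔ F ∈ prismFaces t₀ t₁ l ∧ ∀ q ∈ F, q.1 ∈ S := by
  constructor
  · rintro ⟨hne, j, hj, hF⟩
    obtain ⟨i, hi, hsub⟩ := exists_stair_filter_subset (t₀ := t₀) (t₁ := t₁) S l j hj
    refine ⟨⟨hne, i, hi, hF.trans hsub⟩, fun q hq => ?_⟩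
    obtain ⟨w, hw, h | h⟩ := exists_of_mem_stair (hF hq)
    all_goals rw [h]; simpa using (List.mem_filter.1 hw).2
  · rintro ⟨⟨hne, i, -, hF⟩, hS⟩
    obtain ⟨j, hj, hsub⟩ := exists_subset_stair_filter S l i F hF hne hS
    exact ⟨hne, j, hj, hsub⟩

end Comb

section Geom

variable {W : Type*} [NormedAddCommGroup W] [NormedSpace ℝ W]

section GeomDec

variable [DecidableEq W] {t₀ t₁ : ℝ}

/-! ### Vertical faces: points over a sub-face lie over the sub-prism -/

/-- **Vertical faces.** If a point of the closed simplex of a prism face projects into the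
closed sub-face `conv (l ∩ S)` of the base, it lies in the closed simplex of the vertices over
`S` (affine independence of the base makes the weights over the other vertices vanish).
[folklore] -/
theorem mem_convexHull_filter_fst {l : List W} (hl : AffineIndependent ℝ ((↑) : ↥l.toFinset → W))
    (S : Finset W) {F : Finset (W × ℝ)} (hF : F ∈ prismFaces t₀ t₁ l) {x : W × ℝ}
    (hx : x ∈ convexHull ℝ (F : Set (W × ℝ)))
    (hxS : x.1 ∈ convexHull ℝ (((l.filter fun w => w ∈ S).toFinset : Finset W) : Set W)) :
    x ∈ convexHull ℝ ((F.filter fun q => q.1 ∈ S : Finset (W × ℝ)) : Set (W × ℝ)) := by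
  set T : Finset W := l.toFinset with hT
  -- vertices of `F` project into `T`
  have hFT : ∀ q ∈ F, q.1 ∈ T := fun q hq => by
    obtain ⟨-, i, -, hFi⟩ := hF
    obtain ⟨w, hw, h | h⟩ := exists_of_mem_stair (hFi hq)
    all_goals rw [h]; simpa [hT] using hw
  obtain ⟨w, hw0, hw1, hwx⟩ := Finset.mem_convexHull'.1 hx
  obtain ⟨d, hd0, hd1, hdx⟩ := Finset.mem_convexHull'.1 hxS
  -- regrouped weights on `T`
  set c : W → ℝ := fun u => ∑ q ∈ F with q.1 = u, w q with hc
  have hc1 : ∑ u ∈ T, c u = 1 := by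
    simp only [hc]
    rw [Finset.sum_fiberwise_of_maps_to hFT, hw1]
  have hcx : ∑ u ∈ T, c u • u = x.1 := by
    have h1 : ∑ u ∈ T, c u • u = ∑ u ∈ T, ∑ q ∈ F with q.1 = u, w q • q.1 := by
      refine Finset.sum_congr rfl fun u _ => ?_
      rw [hc, Finset.sum_smul]
      exact Finset.sum_congr rfl fun q hq => by rw [(Finset.mem_filter.1 hq).2]
    rw [h1, Finset.sum_fiberwise_of_maps_to hFT, ← hwx, Prod.fst_sum]
    simp
  -- the weights `d` extended by zero to `T`
  set TS : Finset W := (l.filter fun w => w ∈ S).toFinset with hTS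
  have hTST : TS ⊆ T := fun u hu => by
    simp only [hTS, hT, List.mem_toFinset, List.mem_filter] at hu ⊢; exact hu.1
  let d' : W → ℝ := fun u => if u ∈ TS then d u else 0
  have hd'on : ∀ u ∈ TS, d' u = d u := fun u hu => by simp only [d', if_pos hu]
  have hd'off : ∀ u, u ∉ TS → d' u = 0 := fun u hu => by simp only [d', if_neg hu]
  have hd'1 : ∑ u ∈ T, d' u = 1 := by
    rw [← Finset.sum_subset hTST (f := d') fun u _ hu => hd'off u hu, ← hd1]
    exact Finset.sum_congr rfl fun u hu => hd'on u hu
  have hd'x : ∑ u ∈ T, d' u • u = x.1 := by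
    rw [← Finset.sum_subset hTST (f := fun u => d' u • u) fun u _ hu => by rw [hd'off u hu, zero_smul],
      ← hdx]
    exact Finset.sum_congr rfl fun u hu => by rw [hd'on u hu]
  -- affine independence: `c = d'`
  have hind : AffIndOn (id : W → W) T := affIndOn_iff.2 hl
  have hcd : ∀ u ∈ T, c u = d' u := fun u hu => by
    have h := hind (fun u => c u - d' u) (by rw [Finset.sum_sub_distrib, hc1, hd'1, sub_self])
      (by simp only [id]; simp_rw [sub_smul]; rw [Finset.sum_sub_distrib, hcx, hd'x, sub_self]) u hu
    linarith
  -- weights over vertices off `S` vanish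
  have hzero : ∀ q ∈ F, q.1 ∉ S → w q = 0 := fun q hq hqS => by
    have hu : q.1 ∈ T := hFT q hq
    have hcu : c q.1 = 0 := by
      rw [hcd _ hu]
      refine hd'off _ fun hmem => hqS ?_
      simp only [hTS, List.mem_toFinset, List.mem_filter, decide_eq_true_eq] at hmem
      exact hmem.2
    have h := (Finset.sum_eq_zero_iff_of_nonneg fun q' hq' =>
      hw0 q' (Finset.mem_filter.1 hq').1).1 hcu q (Finset.mem_filter.2 ⟨hq, rfl⟩)
    exact h
  -- conclude
  have hwx' : ∑ q ∈ F.filter (fun q => q.1 ∈ S), w q • q = x := by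
    rw [Finset.sum_filter_of_ne fun q hq hne => ?_, hwx]
    by_contra h; exact hne (by rw [hzero q hq h, zero_smul])
  have hw1' : ∑ q ∈ F.filter (fun q => q.1 ∈ S), w q = 1 := by
    rw [Finset.sum_filter_of_ne fun q hq hne => ?_, hw1]
    by_contra h; exact hne (hzero q hq h)
  rw [← hwx']
  exact (convex_convexHull ℝ _).sum_mem (fun q hq => hw0 q (Finset.mem_of_mem_filter q hq)) hw1'
    fun q hq => subset_convexHull ℝ _ (Finset.mem_coe.2 hq)

/-! ### More level lemmas, projections -/

omit [DecidableEq W] in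
/-- **The highest level of a closed simplex is spanned by its highest vertices.** [folklore] -/
theorem mem_convexHull_filter_of_snd_eq_max {F : Finset (W × ℝ)} {t : ℝ}
    (hF : ∀ p ∈ F, p.2 ≤ t) {x : W × ℝ} (hx : x ∈ convexHull ℝ (F : Set (W × ℝ))) (hxt : x.2 = t) :
    x ∈ convexHull ℝ ((F.filter fun p => p.2 = t : Finset (W × ℝ)) : Set (W × ℝ)) := by
  obtain ⟨w, hw0, hw1, hwx⟩ := Finset.mem_convexHull'.1 hx
  have hsum : ∑ p ∈ F, w p * (t - p.2) = 0 := by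
    have h2 : (∑ p ∈ F, w p • p).2 = ∑ p ∈ F, w p * p.2 := by
      rw [Prod.snd_sum]; simp
    rw [hwx, hxt] at h2
    simp_rw [mul_sub, Finset.sum_sub_distrib, ← h2, ← Finset.sum_mul, hw1, one_mul, sub_self]
  have hzero : ∀ p ∈ F, p.2 ≠ t → w p = 0 := fun p hp hne => by
    have h := (Finset.sum_eq_zero_iff_of_nonneg fun q hq =>
      mul_nonneg (hw0 q hq) (sub_nonneg.2 (hF q hq))).1 hsum p hp
    rcases mul_eq_zero.1 h with h | h
    · exact h
    · exact absurd (sub_eq_zero.1 h).symm hne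
  have hwx' : ∑ p ∈ F.filter (fun p => p.2 = t), w p • p = x := by
    rw [Finset.sum_filter_of_ne fun p hp hne => ?_, hwx]
    by_contra h; exact hne (by rw [hzero p hp h, zero_smul])
  have hw1' : ∑ p ∈ F.filter (fun p => p.2 = t), w p = 1 := by
    rw [Finset.sum_filter_of_ne fun p hp hne => ?_, hw1]
    by_contra h; exact hne (hzero p hp h)
  rw [← hwx']
  exact (convex_convexHull ℝ _).sum_mem (fun p hp => hw0 p (Finset.mem_of_mem_filter p hp)) hw1'
    fun p hp => subset_convexHull ℝ _ (Finset.mem_coe.2 hp)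

omit [DecidableEq W] in
/-- A closed simplex whose vertices have level `≤ t` has level `≤ t`. [folklore] -/
theorem snd_le_of_mem_convexHull {F : Finset (W × ℝ)} {t : ℝ} (hF : ∀ p ∈ F, p.2 ≤ t) {x : W × ℝ}
    (hx : x ∈ convexHull ℝ (F : Set (W × ℝ))) : x.2 ≤ t := by
  have hconv : Convex ℝ {p : W × ℝ | p.2 ≤ t} := by
    have : {p : W × ℝ | p.2 ≤ t} = (AffineMap.snd : W × ℝ →ᵃ[ℝ] ℝ) ⁻¹' Set.Iic t := by ext p; simp
    rw [this]; exact (convex_Iic t).affine_preimage _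
  exact convexHull_min (fun p hp => hF p (Finset.mem_coe.1 hp)) hconv hx

/-- The projection of a closed simplex of `W × ℝ` lies in the closed simplex of the projected
vertices. [folklore] -/
theorem fst_mem_convexHull_image {F : Finset (W × ℝ)} {x : W × ℝ}
    (hx : x ∈ convexHull ℝ (F : Set (W × ℝ))) :
    x.1 ∈ convexHull ℝ ((F.image Prod.fst : Finset W) : Set W) := by
  have h := (LinearMap.fst ℝ W ℝ).image_convexHull (F : Set (W × ℝ))
  have hx' : x.1 ∈ (LinearMap.fst ℝ W ℝ) '' convexHull ℝ (F : Set (W × ℝ)) := ⟨x, hx, rfl⟩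
  rw [h] at hx'
  rwa [Finset.coe_image]

omit [NormedAddCommGroup W] [NormedSpace ℝ W] in
/-- Vertices of prism faces project into the base list. [folklore] -/
theorem image_fst_subset_of_mem_prismFaces {l : List W} {F : Finset (W × ℝ)}
    (hF : F ∈ prismFaces t₀ t₁ l) : F.image Prod.fst ⊆ l.toFinset := by
  intro u hu
  obtain ⟨q, hq, rfl⟩ := Finset.mem_image.1 hu
  obtain ⟨-, i, -, hFi⟩ := hF
  obtain ⟨w, hw, h | h⟩ := exists_of_mem_stair (hFi hq)
  all_goals rw [h]; simpa using hw

end GeomDec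

/-! ## The product complex of a finite complex with a subdivided interval -/

section ProductCx

variable [DecidableEq W] {K : Geometry.SimplicialComplex ℝ W}

/-- The ordered vertex list of a face: the sublist of the global vertex list. [folklore] -/
def faceList (L : List W) (σ : Finset W) : List W := L.filter fun w => w ∈ σ

omit [NormedAddCommGroup W] [NormedSpace ℝ W] in
/-- Auxiliary (`faceList_toFinset`). [folklore] -/
theorem faceList_toFinset {L : List W} {σ : Finset W} (hσ : σ ⊆ L.toFinset) :
    (faceList L σ).toFinset = σ := by
  ext w
  rw [faceList, List.mem_toFinset, List.mem_filter, decide_eq_true_eq]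
  exact ⟨fun h => h.2, fun h => ⟨List.mem_toFinset.1 (hσ h), h⟩⟩

omit [NormedAddCommGroup W] [NormedSpace ℝ W] in
/-- Auxiliary (`faceList_nodup`). [folklore] -/
theorem faceList_nodup {L : List W} (hL : L.Nodup) (σ : Finset W) : (faceList L σ).Nodup :=
  hL.filter _

omit [NormedAddCommGroup W] [NormedSpace ℝ W] in
/-- Restricting the vertex list of a face to a subface gives the vertex list of the subface.
[folklore] -/
theorem faceList_filter {L : List W} {σ S : Finset W} (hS : S ⊆ σ) :
    (faceList L σ).filter (fun w => w ∈ S) = faceList L S := by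
  rw [faceList, faceList, List.filter_filter]
  congr 1
  ext w
  by_cases h : w ∈ S
  · simp [h, hS h]
  · simp [h]

/-- Faces of `K` inside the global vertex list are affinely independent as lists. [folklore] -/
theorem affineIndependent_faceList {L : List W} {σ : Finset W} (hσ : σ ∈ K.faces)
    (hσL : σ ⊆ L.toFinset) :
    AffineIndependent ℝ ((↑) : ↥(faceList L σ).toFinset → W) := by
  rw [faceList_toFinset hσL]
  exact K.indep hσ

/-- **The faces of the product complex**: the prism faces over the faces of `K`, slab by
slab. [folklore] -/
def productFaces (K : Geometry.SimplicialComplex ℝ W) (L : List W) (t : ℕ → ℝ) (N : ℕ) :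
    Set (Finset (W × ℝ)) :=
  ⋃ a ∈ Finset.range N, ⋃ σ ∈ K.faces, prismFaces (t a) (t (a + 1)) (faceList L σ)

/-- Membership in the product faces. [folklore] -/
theorem mem_productFaces_iff {L : List W} {t : ℕ → ℝ} {N : ℕ} {F : Finset (W × ℝ)} :
    F ∈ productFaces K L t N ↔ ∃ a, a < N ∧ ∃ σ ∈ K.faces, F ∈ prismFaces (t a) (t (a + 1)) (faceList L σ) := by
  unfold productFaces
  constructor
  · intro h
    obtain ⟨a, ha, h⟩ := Set.mem_iUnion₂.1 h
    obtain ⟨σ, hσ, h⟩ := Set.mem_iUnion₂.1 h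
    exact ⟨a, Finset.mem_range.1 ha, σ, hσ, h⟩
  · rintro ⟨a, ha, σ, hσ, h⟩
    exact Set.mem_iUnion₂.2 ⟨a, Finset.mem_range.2 ha, Set.mem_iUnion₂.2 ⟨σ, hσ, h⟩⟩

/-- **Intersections within one slab.** [folklore] -/
theorem inter_subset_same_slab {L : List W} (hL : L.Nodup) (hKL : ∀ σ ∈ K.faces, σ ⊆ L.toFinset)
    {t₀' t₁' : ℝ} (ht : t₀' < t₁') {σ₁ σ₂ : Finset W} (hσ₁ : σ₁ ∈ K.faces) (hσ₂ : σ₂ ∈ K.faces)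
    {F₁ F₂ : Finset (W × ℝ)} (hF₁ : F₁ ∈ prismFaces t₀' t₁' (faceList L σ₁))
    (hF₂ : F₂ ∈ prismFaces t₀' t₁' (faceList L σ₂)) :
    convexHull ℝ (F₁ : Set (W × ℝ)) ∩ convexHull ℝ (F₂ : Set (W × ℝ)) ⊆
      convexHull ℝ ((F₁ : Set (W × ℝ)) ∩ ↑F₂) := by
  intro x hx
  -- project to the base
  have hx1 : x.1 ∈ convexHull ℝ (σ₁ : Set W) ∩ convexHull ℝ (σ₂ : Set W) := by
    constructor
    · have h := fst_mem_convexHull_image hx.1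
      exact convexHull_mono (Finset.coe_subset.2 ((image_fst_subset_of_mem_prismFaces hF₁).trans
        (by rw [faceList_toFinset (hKL σ₁ hσ₁)]))) h
    · have h := fst_mem_convexHull_image hx.2
      exact convexHull_mono (Finset.coe_subset.2 ((image_fst_subset_of_mem_prismFaces hF₂).trans
        (by rw [faceList_toFinset (hKL σ₂ hσ₂)]))) h
  have hx1' : x.1 ∈ convexHull ℝ ((σ₁ : Set W) ∩ ↑σ₂) := K.inter_subset_convexHull hσ₁ hσ₂ hx1
  set S : Finset W := σ₁ ∩ σ₂ with hS
  -- restrict both faces to the vertices over `S`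
  have hLS : ∀ {σ : Finset W}, S ⊆ σ →
      convexHull ℝ ((((faceList L σ).filter fun w => w ∈ S).toFinset : Finset W) : Set W) =
        convexHull ℝ (S : Set W) := fun {σ} hSσ => by
    rw [faceList_filter hSσ, faceList_toFinset ((Finset.inter_subset_left).trans (hKL σ₁ hσ₁))]
  have hG₁ := mem_convexHull_filter_fst (affineIndependent_faceList hσ₁ (hKL σ₁ hσ₁)) S hF₁ hx.1
    (by rw [hLS Finset.inter_subset_left, Finset.coe_inter]; exact hx1')
  have hG₂ := mem_convexHull_filter_fst (affineIndependent_faceList hσ₂ (hKL σ₂ hσ₂)) S hF₂ hx.2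
    (by rw [hLS Finset.inter_subset_right, Finset.coe_inter]; exact hx1')
  set G₁ : Finset (W × ℝ) := F₁.filter fun q => q.1 ∈ S with hG₁def
  set G₂ : Finset (W × ℝ) := F₂.filter fun q => q.1 ∈ S with hG₂def
  have hG₁ne : G₁.Nonempty := by
    by_contra h; rw [Finset.not_nonempty_iff_eq_empty] at h
    rw [h, Finset.coe_empty, convexHull_empty] at hG₁; exact hG₁
  have hG₂ne : G₂.Nonempty := by
    by_contra h; rw [Finset.not_nonempty_iff_eq_empty] at h
    rw [h, Finset.coe_empty, convexHull_empty] at hG₂; exact hG₂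
  -- both restricted faces are faces of the prism over `S`
  have hmem₁ : G₁ ∈ prismFaces t₀' t₁' (faceList L S) := by
    rw [← faceList_filter Finset.inter_subset_left, prismFaces_filter_iff]
    refine ⟨⟨hG₁ne, ?_⟩, fun q hq => (Finset.mem_filter.1 hq).2⟩
    obtain ⟨-, i, hi, hFi⟩ := hF₁
    exact ⟨i, hi, (Finset.filter_subset _ F₁).trans hFi⟩
  have hmem₂ : G₂ ∈ prismFaces t₀' t₁' (faceList L S) := by
    rw [← faceList_filter Finset.inter_subset_right, prismFaces_filter_iff]
    refine ⟨⟨hG₂ne, ?_⟩, fun q hq => (Finset.mem_filter.1 hq).2⟩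
    obtain ⟨-, i, hi, hFi⟩ := hF₂
    exact ⟨i, hi, (Finset.filter_subset _ F₂).trans hFi⟩
  have hSK : S ∈ K.faces ∨ S = ∅ := by
    rcases S.eq_empty_or_nonempty with h | h
    · exact Or.inr h
    · exact Or.inl (K.down_closed hσ₁ Finset.inter_subset_left h)
  rcases hSK with hSK | hS0
  · obtain ⟨KS, hKS⟩ := exists_prismComplex ht (faceList L S) (faceList_nodup hL S)
      (affineIndependent_faceList hSK (hKL S hSK))
    have hax := KS.inter_subset_convexHull (hKS ▸ hmem₁) (hKS ▸ hmem₂) ⟨hG₁, hG₂⟩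
    refine convexHull_mono ?_ hax
    exact Set.inter_subset_inter (Finset.coe_subset.2 (Finset.filter_subset _ F₁))
      (Finset.coe_subset.2 (Finset.filter_subset _ F₂))
  · exfalso
    obtain ⟨q, hq⟩ := hG₁ne
    have := (Finset.mem_filter.1 hq).2
    rw [hS0] at this; exact absurd this (Finset.notMem_empty _)


omit [NormedAddCommGroup W] [NormedSpace ℝ W] [DecidableEq W] in
/-- A point at level `s` is the lift of its projection. [folklore] -/
theorem liftV_fst_eq_of_snd_eq {q : W × ℝ} {s : ℝ} (hq : q.2 = s) : liftV s q.1 = q :=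
  Prod.ext rfl hq.symm

/-- **Intersections across adjacent slabs** happen at the common level and are governed by the
base complex. [folklore] -/
theorem inter_subset_adjacent_slab {L : List W} (hKL : ∀ σ ∈ K.faces, σ ⊆ L.toFinset)
    {r s u : ℝ} (hrs : r < s) (hsu : s < u) {σ₁ σ₂ : Finset W} (hσ₁ : σ₁ ∈ K.faces) (hσ₂ : σ₂ ∈ K.faces)
    {F₁ F₂ : Finset (W × ℝ)} (hF₁ : F₁ ∈ prismFaces r s (faceList L σ₁))
    (hF₂ : F₂ ∈ prismFaces s u (faceList L σ₂)) :
    convexHull ℝ (F₁ : Set (W × ℝ)) ∩ convexHull ℝ (F₂ : Set (W × ℝ)) ⊆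
      convexHull ℝ ((F₁ : Set (W × ℝ)) ∩ ↑F₂) := by
  intro x hx
  -- the common level
  have hle₁ : ∀ p ∈ F₁, p.2 ≤ s := fun p hp => by
    obtain ⟨-, i, -, hFi⟩ := hF₁
    obtain ⟨w, -, h | h⟩ := exists_of_mem_stair (hFi hp)
    · rw [h]; exact hrs.le
    · rw [h]; exact le_rfl
  have hge₂ : ∀ p ∈ F₂, s ≤ p.2 := fun p hp => le_snd_of_mem_prismFace hsu.le hF₂ hp
  have hxs : x.2 = s := le_antisymm (snd_le_of_mem_convexHull hle₁ hx.1) (le_snd_of_mem_convexHull hge₂ hx.2)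
  set G₁ : Finset (W × ℝ) := F₁.filter fun p => p.2 = s with hG₁def
  set G₂ : Finset (W × ℝ) := F₂.filter fun p => p.2 = s with hG₂def
  have hxG₁ : x ∈ convexHull ℝ (G₁ : Set (W × ℝ)) := mem_convexHull_filter_of_snd_eq_max hle₁ hx.1 hxs
  have hxG₂ : x ∈ convexHull ℝ (G₂ : Set (W × ℝ)) := mem_convexHull_filter_of_snd_eq hge₂ hx.2 hxs
  -- project to the base complex
  have hπ₁ : G₁.image Prod.fst ⊆ σ₁ :=
    ((Finset.image_subset_image (Finset.filter_subset _ F₁)).trans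
      (image_fst_subset_of_mem_prismFaces hF₁)).trans (by rw [faceList_toFinset (hKL σ₁ hσ₁)])
  have hπ₂ : G₂.image Prod.fst ⊆ σ₂ :=
    ((Finset.image_subset_image (Finset.filter_subset _ F₂)).trans
      (image_fst_subset_of_mem_prismFaces hF₂)).trans (by rw [faceList_toFinset (hKL σ₂ hσ₂)])
  have hne₁ : (G₁.image Prod.fst).Nonempty := by
    rw [Finset.image_nonempty]
    by_contra h; rw [Finset.not_nonempty_iff_eq_empty] at h
    rw [h, Finset.coe_empty, convexHull_empty] at hxG₁; exact hxG₁
  have hne₂ : (G₂.image Prod.fst).Nonempty := by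
    rw [Finset.image_nonempty]
    by_contra h; rw [Finset.not_nonempty_iff_eq_empty] at h
    rw [h, Finset.coe_empty, convexHull_empty] at hxG₂; exact hxG₂
  have hface₁ : G₁.image Prod.fst ∈ K.faces := K.down_closed hσ₁ hπ₁ hne₁
  have hface₂ : G₂.image Prod.fst ∈ K.faces := K.down_closed hσ₂ hπ₂ hne₂
  have hx1 : x.1 ∈ convexHull ℝ (((G₁.image Prod.fst : Finset W) : Set W) ∩ ↑(G₂.image Prod.fst)) :=
    K.inter_subset_convexHull hface₁ hface₂ ⟨fst_mem_convexHull_image hxG₁, fst_mem_convexHull_image hxG₂⟩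
  -- lift back to the level `s`
  obtain ⟨f, hf⟩ := exists_affineMap_liftV (W := W) s
  have hxlift : x = f x.1 := by rw [hf, liftV_fst_eq_of_snd_eq hxs]
  have himg : f '' ((((G₁.image Prod.fst : Finset W) : Set W)) ∩ ↑(G₂.image Prod.fst)) ⊆ (F₁ : Set (W × ℝ)) ∩ ↑F₂ := by
    rintro _ ⟨w, ⟨hw₁, hw₂⟩, rfl⟩
    rw [hf]
    obtain ⟨q₁, hq₁, rfl⟩ := Finset.mem_image.1 (Finset.mem_coe.1 hw₁)
    obtain ⟨q₂, hq₂, hq₂₁⟩ := Finset.mem_image.1 (Finset.mem_coe.1 hw₂)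
    obtain ⟨hq₁F, hq₁s⟩ := Finset.mem_filter.1 hq₁
    obtain ⟨hq₂F, hq₂s⟩ := Finset.mem_filter.1 hq₂
    constructor
    · rw [liftV_fst_eq_of_snd_eq hq₁s]; exact hq₁F
    · rw [← hq₂₁, liftV_fst_eq_of_snd_eq hq₂s]; exact hq₂F
  rw [hxlift]
  have h := (Set.mem_image_of_mem f hx1)
  rw [AffineMap.image_convexHull] at h
  exact convexHull_mono himg h

/-- **Faces in far-apart slabs do not meet.** [folklore] -/
theorem inter_eq_empty_far_slabs {l₁ l₂ : List W} {r s s' u : ℝ} (hrs : r ≤ s) (hss' : s < s')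
    (hsu : s' ≤ u) {F₁ F₂ : Finset (W × ℝ)} (hF₁ : F₁ ∈ prismFaces r s l₁)
    (hF₂ : F₂ ∈ prismFaces s' u l₂) :
    convexHull ℝ (F₁ : Set (W × ℝ)) ∩ convexHull ℝ (F₂ : Set (W × ℝ)) = ∅ := by
  ext x
  simp only [Set.mem_inter_iff, Set.mem_empty_iff_false, iff_false, not_and]
  intro hx₁ hx₂
  have hle₁ : ∀ p ∈ F₁, p.2 ≤ s := fun p hp => by
    obtain ⟨-, i, -, hFi⟩ := hF₁
    obtain ⟨w, -, h | h⟩ := exists_of_mem_stair (hFi hp)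
    · rw [h]; exact hrs
    · rw [h]; exact le_rfl
  have h1 := snd_le_of_mem_convexHull hle₁ hx₁
  have h2 := le_snd_of_mem_convexHull (fun p hp => le_snd_of_mem_prismFace hsu hF₂ hp) hx₂
  linarith

/-- **The product complex** `K × [t 0, t N]` of a finite geometric complex `K` (vertices inside
the duplicate-free list `L`) with the interval subdivided at the levels `t 0 < t 1 < … < t N`:
faces are the staircase prism faces over the faces of `K`, slab by slab.
[cite: RourkeSanderson1972, Ch. 2 (cells σ × I); Rushing1973, proof of Thm. 4.12.1 (cells σ × [t_{i-1}, t_i])] -/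
def productComplex (K : Geometry.SimplicialComplex ℝ W) (L : List W) (hL : L.Nodup)
    (hKL : ∀ σ ∈ K.faces, σ ⊆ L.toFinset) (t : ℕ → ℝ) (ht : StrictMono t) (N : ℕ) :
    Geometry.SimplicialComplex ℝ (W × ℝ) where
  faces := productFaces K L t N
  isRelLowerSet_faces := by
    intro F hF
    obtain ⟨a, ha, σ, hσ, hne, i, hi, hFi⟩ := mem_productFaces_iff.1 hF
    exact ⟨hne, fun G hGF hGne => mem_productFaces_iff.2 ⟨a, ha, σ, hσ, hGne, i, hi, hGF.trans hFi⟩⟩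
  indep := by
    intro F hF
    obtain ⟨a, ha, σ, hσ, hFp⟩ := mem_productFaces_iff.1 hF
    obtain ⟨KS, hKS⟩ := exists_prismComplex (ht (Nat.lt_succ_self a)) (faceList L σ)
      (faceList_nodup hL σ) (affineIndependent_faceList hσ (hKL σ hσ))
    exact KS.indep (hKS ▸ hFp)
  inter_subset_convexHull := by
    intro F₁ F₂ hF₁ hF₂
    obtain ⟨a, ha, σ₁, hσ₁, hF₁p⟩ := mem_productFaces_iff.1 hF₁
    obtain ⟨b, hb, σ₂, hσ₂, hF₂p⟩ := mem_productFaces_iff.1 hF₂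
    -- compare the slabs
    have key : ∀ {a b : ℕ} {σ₁ σ₂ : Finset W} {F₁ F₂ : Finset (W × ℝ)}, a ≤ b → σ₁ ∈ K.faces → σ₂ ∈ K.faces →
        F₁ ∈ prismFaces (t a) (t (a + 1)) (faceList L σ₁) →
        F₂ ∈ prismFaces (t b) (t (b + 1)) (faceList L σ₂) →
        convexHull ℝ (F₁ : Set (W × ℝ)) ∩ convexHull ℝ (F₂ : Set (W × ℝ)) ⊆
          convexHull ℝ ((F₁ : Set (W × ℝ)) ∩ ↑F₂) := by
      intro a b σ₁ σ₂ F₁ F₂ hab hσ₁ hσ₂ hF₁ hF₂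
      rcases hab.eq_or_lt with rfl | hlt
      · exact inter_subset_same_slab hL hKL (ht (Nat.lt_succ_self a)) hσ₁ hσ₂ hF₁ hF₂
      · rcases (Nat.succ_le_of_lt hlt).eq_or_lt with h1 | h2
        · subst h1
          exact inter_subset_adjacent_slab hKL (ht (Nat.lt_succ_self a)) (ht (Nat.lt_succ_self _))
            hσ₁ hσ₂ hF₁ hF₂
        · rw [inter_eq_empty_far_slabs (ht (Nat.lt_succ_self a)).le (ht h2) (ht (Nat.lt_succ_self b)).le
            hF₁ hF₂]
          exact Set.empty_subset _
    rcases le_total a b with hab | hba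
    · exact key hab hσ₁ hσ₂ hF₁p hF₂p
    · have h := key hba hσ₂ hσ₁ hF₂p hF₁p
      rw [Set.inter_comm] at h
      rw [Set.inter_comm (F₁ : Set (W × ℝ))]
      exact h

/-- The faces of the product complex. [folklore] -/
theorem productComplex_faces (K : Geometry.SimplicialComplex ℝ W) (L : List W) (hL : L.Nodup)
    (hKL : ∀ σ ∈ K.faces, σ ⊆ L.toFinset) (t : ℕ → ℝ) (ht : StrictMono t) (N : ℕ) :
    (productComplex K L hL hKL t ht N).faces = productFaces K L t N := rfl

/-- The product complex of a finite complex is finite. [folklore] -/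
theorem productComplex_faces_finite (K : Geometry.SimplicialComplex ℝ W) (L : List W) (hL : L.Nodup)
    (hKL : ∀ σ ∈ K.faces, σ ⊆ L.toFinset) (t : ℕ → ℝ) (ht : StrictMono t) (N : ℕ)
    (hfin : K.faces.Finite) : (productComplex K L hL hKL t ht N).faces.Finite := by
  rw [productComplex_faces, productFaces]
  refine Set.Finite.biUnion (Finset.finite_toSet _) fun a _ => Set.Finite.biUnion hfin fun σ _ => ?_
  -- faces of one prism: subsets of finitely many staircase simplices
  refine Set.Finite.subset ((Finset.range (faceList L σ).length).finite_toSet.biUnion fun i _ =>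
    (stair (t a) (t (a + 1)) (faceList L σ) i).powerset.finite_toSet) fun F hF => ?_
  obtain ⟨-, i, hi, hFi⟩ := hF
  exact Set.mem_iUnion₂.2 ⟨i, Finset.mem_range.2 hi, Finset.mem_powerset.2 hFi⟩

/-- **The underlying space of the product complex** is `|K| × [t 0, t N]`, slab by slab.
[folklore] -/
theorem productComplex_space (K : Geometry.SimplicialComplex ℝ W) (L : List W) (hL : L.Nodup)
    (hKL : ∀ σ ∈ K.faces, σ ⊆ L.toFinset) (t : ℕ → ℝ) (ht : StrictMono t) (N : ℕ) :
    (productComplex K L hL hKL t ht N).space =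
      {p | p.1 ∈ K.space ∧ ∃ a, a < N ∧ p.2 ∈ Set.Icc (t a) (t (a + 1))} := by
  ext p
  rw [Geometry.SimplicialComplex.mem_space_iff]
  simp only [productComplex_faces, mem_productFaces_iff, Set.mem_setOf_eq]
  constructor
  · rintro ⟨F, ⟨a, ha, σ, hσ, hF⟩, hpF⟩
    have hp : p ∈ prismSet (t a) (t (a + 1)) (faceList L σ) := by
      rw [← iUnion_prismFaces_eq (ht (Nat.lt_succ_self a)) (faceList L σ) (faceList_nodup hL σ)]
      exact Set.mem_iUnion₂.2 ⟨F, hF, hpF⟩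
    obtain ⟨hp1, hp2⟩ := hp
    rw [faceList_toFinset (hKL σ hσ)] at hp1
    exact ⟨Geometry.SimplicialComplex.mem_space_iff.2 ⟨σ, hσ, hp1⟩, a, ha, hp2⟩
  · rintro ⟨hp1, a, ha, hp2⟩
    obtain ⟨σ, hσ, hpσ⟩ := Geometry.SimplicialComplex.mem_space_iff.1 hp1
    have hp : p ∈ prismSet (t a) (t (a + 1)) (faceList L σ) := by
      refine ⟨?_, hp2⟩
      rw [faceList_toFinset (hKL σ hσ)]; exact hpσ
    rw [← iUnion_prismFaces_eq (ht (Nat.lt_succ_self a)) (faceList L σ) (faceList_nodup hL σ)] at hp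
    obtain ⟨F, hF, hpF⟩ := Set.mem_iUnion₂.1 hp
    exact ⟨F, ⟨a, ha, σ, hσ, hF⟩, hpF⟩

end ProductCx

end Geom

end Literature.Topology.FourManifolds
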